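import Summits.PneNP.PneNP.Theses.ForcedSplits

/-!
# Route ForcedSplits — invariants of the UP-guided path (helper for `AccountingLemma`, stmt-PneNP-8178)

The UP-guided flow of the route is an `n`-fold iterate of a one-step map `F` on states `(current formula, records)`,
each record `(parent, variable, value, forced?)`, newest first. Abstracting `F` by its one-step behaviour (stay, or
restrict the current formula at a fresh variable and push a record) we prove, generically:
* the RUN INVARIANT (`forcedSplits_run_invariant`): the formulas `current :: parents` form a restriction chain ending
  at the root, forced records have their unit clause in the parent, recorded variables are distinct, `< n`, and absent
  from the current formula, and either every step made progress or the state is a fixed point;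
* the EMPTY CLAUSE AT THE END (`forcedSplits_nil_mem_final`): from an unsatisfiable root whose variables are `< n`,
  after `n` steps the current formula contains the empty clause;
* the ACCOUNTING STEP (`forcedSplits_clean_of_noViolation`): if no record violates `g(parent) = g(child₀) ∨ g(child₁)`,
  `g(root) = 1` and `g(current) = 0`, the label sequence is `1…10…0` with its drop at a free step whose sibling is
  labelled `1` — the route's `clean`.
-/

set_option linter.dupNamespace false -- `Summit.PneNP.PneNP.…`: summit = sub-problem name (D-0017 single-conjunct layout)

namespace Summit.PneNP.PneNP.Theorems

open Literature.Computability.Complexity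

/-- Parents in the list of formulas `current :: parents`. [folklore] -/
theorem forcedSplits_tops_getD_succ (s : CNF ℕ × List (CNF ℕ × ℕ × Bool × Bool)) {j : ℕ} (hj : j < s.2.length) :
    (s.1 :: s.2.map Prod.fst).getD (j + 1) [] = (s.2.getD j ([], 0, false, false)).1 := by
  rw [List.getD_cons_succ, List.getD_eq_getElem _ _ (by simpa using hj), List.getD_eq_getElem _ _ hj, List.getElem_map]

/-- Reading a mapped reversed list from the front is reading the list from the back. [folklore] -/
theorem forcedSplits_getD_reverse_map {α β : Type} (l : List α) (f : α → β) (d : α) (x : β) {t : ℕ} (ht : t < l.length) :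
    (l.reverse.map f).getD t x = f (l.getD (l.length - 1 - t) d) := by
  rw [List.getD_eq_getElem _ _ (by simpa using ht), List.getD_eq_getElem _ _ (by omega), List.getElem_map, List.getElem_reverse]

/-- **The run invariant.** For a one-step map `F` that either stays or restricts the current formula at a variable that
is fresh (it occurs in the current formula, or is `< n` and unrecorded) and pushes the record, and a restriction `R`
whose result only keeps literals of the input off the restricted variable: after `m` steps from `(φ, [])` (all variables
of `φ` below `n`) — chain, root, forced unit clauses, variable bookkeeping, progress-or-fixed. [folklore] -/
theorem forcedSplits_run_invariant (n : ℕ)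
    (F : CNF ℕ × List (CNF ℕ × ℕ × Bool × Bool) → CNF ℕ × List (CNF ℕ × ℕ × Bool × Bool)) (R : CNF ℕ → ℕ → Bool → CNF ℕ)
    (φ : CNF ℕ) (hφ : ∀ c ∈ φ, ∀ l ∈ c, l.1 < n)
    (hstep : ∀ s, F s = s ∨ ∃ (v : ℕ) (b f : Bool), F s = (R s.1 v b, (s.1, v, b, f) :: s.2) ∧
      (f = true → [(v, b)] ∈ s.1) ∧ ((∃ c ∈ s.1, ∃ l ∈ c, l.1 = v) ∨ (v < n ∧ v ∉ s.2.map fun r => r.2.1)))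
    (hR : ∀ (ψ : CNF ℕ) (v : ℕ) (b : Bool), ∀ c ∈ R ψ v b, ∀ l ∈ c, (∃ c' ∈ ψ, l ∈ c') ∧ l.1 ≠ v) (m : ℕ) :
    ∀ s, s = F^[m] (φ, []) →
      (∀ j, j < s.2.length → (s.1 :: s.2.map Prod.fst).getD j [] =
        R ((s.1 :: s.2.map Prod.fst).getD (j + 1) []) (s.2.getD j ([], 0, false, false)).2.1 (s.2.getD j ([], 0, false, false)).2.2.1) ∧
      (s.1 :: s.2.map Prod.fst).getD s.2.length [] = φ ∧
      (∀ r ∈ s.2, r.2.2.2 = true → [(r.2.1, r.2.2.1)] ∈ r.1) ∧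
      (∀ c ∈ s.1, ∀ l ∈ c, l.1 < n ∧ l.1 ∉ s.2.map fun r => r.2.1) ∧
      (s.2.map fun r => r.2.1).Nodup ∧ (∀ v ∈ s.2.map (fun r => r.2.1), v < n) ∧
      (s.2.length = m ∨ F s = s) := by
  induction m with
  | zero =>
    rintro s rfl
    refine ⟨fun j hj => absurd hj (by simp), by simp, fun r hr => absurd hr (by simp), fun c hc l hl => ⟨hφ c hc l hl, by simp⟩,
      by simp, fun v hv => absurd hv (by simp), Or.inl rfl⟩
  | succ m ih =>
    rintro s' rfl
    rw [Function.iterate_succ_apply']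
    obtain ⟨ha1, ha2, hb, hc1, hc2, hc3, hd⟩ := ih _ rfl
    set s := F^[m] (φ, []) with hs
    rcases hstep s with hfix | ⟨v, b, f, hF, hforced, hv⟩
    · rw [hfix]
      exact ⟨ha1, ha2, hb, hc1, hc2, hc3, Or.inr hfix⟩
    · have hvrec : v ∉ s.2.map fun r => r.2.1 := by
        rcases hv with ⟨c, hc, l, hl, rfl⟩ | ⟨-, h⟩
        · exact (hc1 c hc l hl).2
        · exact h
      have hvn : v < n := by
        rcases hv with ⟨c, hc, l, hl, rfl⟩ | ⟨h, -⟩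
        · exact (hc1 c hc l hl).1
        · exact h
      rw [hF]
      refine ⟨?_, ?_, ?_, ?_, ?_, ?_, ?_⟩
      · intro j hj
        simp only [List.map_cons]
        rcases j with _ | j
        · simp
        · simp only [List.length_cons] at hj
          rw [List.getD_cons_succ, List.getD_cons_succ, List.getD_cons_succ]
          exact ha1 j (by omega)
      · simp only [List.map_cons, List.length_cons, List.getD_cons_succ]
        exact ha2
      · intro r hr
        rcases List.mem_cons.1 hr with rfl | hr
        · exact hforced
        · exact hb r hr
      · intro c hc l hl
        obtain ⟨⟨c', hc', hl'⟩, hne⟩ := hR _ _ _ c hc l hl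
        obtain ⟨h1, h2⟩ := hc1 c' hc' l hl'
        refine ⟨h1, ?_⟩
        simp only [List.map_cons, List.mem_cons, not_or]
        exact ⟨hne, h2⟩
      · simp only [List.map_cons, List.nodup_cons]
        exact ⟨hvrec, hc2⟩
      · intro w hw
        simp only [List.map_cons, List.mem_cons] at hw
        rcases hw with rfl | hw
        · exact hvn
        · exact hc3 w hw
      · rcases hd with hd | hd
        · left; simp [hd]
        · exfalso
          have := congrArg (fun p => p.2.length) (hd.symm.trans hF)
          simp at this

/-- **The empty clause at the end.** If moreover fixed points off the empty clause have every variable `< n` recorded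
and satisfiability lifts along `R`, then from an unsatisfiable root the current formula after `n` steps contains the
empty clause. [folklore] -/
theorem forcedSplits_nil_mem_final (n : ℕ)
    (F : CNF ℕ × List (CNF ℕ × ℕ × Bool × Bool) → CNF ℕ × List (CNF ℕ × ℕ × Bool × Bool)) (R : CNF ℕ → ℕ → Bool → CNF ℕ)
    (φ : CNF ℕ) (hφ : ∀ c ∈ φ, ∀ l ∈ c, l.1 < n) (hunsat : ¬ φ.Satisfiable)
    (hstep : ∀ s, F s = s ∨ ∃ (v : ℕ) (b f : Bool), F s = (R s.1 v b, (s.1, v, b, f) :: s.2) ∧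
      (f = true → [(v, b)] ∈ s.1) ∧ ((∃ c ∈ s.1, ∃ l ∈ c, l.1 = v) ∨ (v < n ∧ v ∉ s.2.map fun r => r.2.1)))
    (hR : ∀ (ψ : CNF ℕ) (v : ℕ) (b : Bool), ∀ c ∈ R ψ v b, ∀ l ∈ c, (∃ c' ∈ ψ, l ∈ c') ∧ l.1 ≠ v)
    (hhalt : ∀ s, F s = s → ([] : Clause ℕ) ∉ s.1 → ∀ v, v < n → v ∈ s.2.map fun r => r.2.1)
    (hsat : ∀ (ψ : CNF ℕ) (v : ℕ) (b : Bool), (R ψ v b).Satisfiable → ψ.Satisfiable) :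
    ([] : Clause ℕ) ∈ (F^[n] (φ, [])).1 := by
  classical
  obtain ⟨ha1, ha2, -, hc1, hc2, hc3, hd⟩ := forcedSplits_run_invariant n F R φ hφ hstep hR n _ rfl
  set s := F^[n] (φ, []) with hs
  by_contra h0
  -- every variable `< n` is recorded
  have hall : ∀ v, v < n → v ∈ s.2.map fun r => r.2.1 := by
    rcases hd with hlen | hfix
    · intro v hv
      have hsub : (s.2.map fun r => r.2.1).toFinset ⊆ Finset.range n := fun w hw => by
        rw [List.mem_toFinset] at hw
        exact Finset.mem_range.2 (hc3 w hw)
      have hcard : (Finset.range n).card ≤ (s.2.map fun r => r.2.1).toFinset.card := by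
        rw [Finset.card_range, List.toFinset_card_of_nodup hc2, List.length_map, hlen]
      have heq := Finset.eq_of_subset_of_card_le hsub hcard
      rw [← List.mem_toFinset, heq]
      exact Finset.mem_range.2 hv
    · exact hhalt s hfix h0
  -- so the current formula has no literals, hence is empty, hence satisfiable
  have hnil : s.1 = [] := by
    rcases hq : s.1 with _ | ⟨c, rest⟩
    · rfl
    · exfalso
      have hc : c ∈ s.1 := by rw [hq]; exact List.mem_cons_self ..
      rcases c with _ | ⟨l, c'⟩
      · exact h0 hc
      · have h := hc1 _ hc l (List.mem_cons_self ..)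
        exact h.2 (hall _ h.1)
  -- satisfiability climbs the chain up to the root
  have hclimb : ∀ j, j ≤ s.2.length → ((s.1 :: s.2.map Prod.fst).getD j []).Satisfiable := by
    intro j
    induction j with
    | zero => intro _; rw [List.getD_cons_zero, hnil]; exact CNF.satisfiable_nil
    | succ j ih =>
      intro hj
      have h := ha1 j (by omega)
      exact hsat _ _ _ (h ▸ ih (by omega))
  exact hunsat (ha2 ▸ hclimb s.2.length le_rfl)

/-- **The accounting step.** With the chain and forced-unit invariants, if `g` vanishes on formulas with the empty
clause, `g(root) = 1`, the current formula contains the empty clause, forced siblings contain the empty clause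
(`[(v,b)] ∈ ψ → [] ∈ R ψ v ¬b`), and NO record violates `g(parent) = g(R parent v 0) ∨ g(R parent v 1)`, then the
path is clean: labels `1…10…0` in chronological order, the drop at a free record whose sibling is labelled `1`.
[folklore] -/
theorem forcedSplits_clean_of_noViolation (R : CNF ℕ → ℕ → Bool → CNF ℕ) (φ : CNF ℕ) (g : CNF ℕ → Bool)
    (s : CNF ℕ × List (CNF ℕ × ℕ × Bool × Bool))
    (ha1 : ∀ j, j < s.2.length → (s.1 :: s.2.map Prod.fst).getD j [] =
      R ((s.1 :: s.2.map Prod.fst).getD (j + 1) []) (s.2.getD j ([], 0, false, false)).2.1 (s.2.getD j ([], 0, false, false)).2.2.1)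
    (ha2 : (s.1 :: s.2.map Prod.fst).getD s.2.length [] = φ)
    (hb : ∀ r ∈ s.2, r.2.2.2 = true → [(r.2.1, r.2.2.1)] ∈ r.1)
    (hg0 : ∀ ψ : CNF ℕ, ([] : Clause ℕ) ∈ ψ → g ψ = false) (hroot : g φ = true) (hnil : ([] : Clause ℕ) ∈ s.1)
    (hunit : ∀ (ψ : CNF ℕ) (v : ℕ) (b : Bool), [(v, b)] ∈ ψ → ([] : Clause ℕ) ∈ R ψ v (!b))
    (hnov : ∀ r ∈ s.2, g r.1 = (g (R r.1 r.2.1 false) || g (R r.1 r.2.1 true))) :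
    ∃ a : ℕ, a < s.2.length ∧
      (∀ t : ℕ, t ≤ s.2.length → (((s.2.reverse.map fun r => g r.1) ++ [g s.1]).getD t false = true ↔ t ≤ a)) ∧
      (s.2.reverse.getD a ([], 0, false, false)).2.2.2 = false ∧
      g (R (s.2.reverse.getD a ([], 0, false, false)).1 (s.2.reverse.getD a ([], 0, false, false)).2.1
        (!(s.2.reverse.getD a ([], 0, false, false)).2.2.1)) = true := by
  classical
  set len := s.2.length with hlen
  set tops := s.1 :: s.2.map Prod.fst with htops
  -- one step of the chain, newest first: `g tops[j+1] = g tops[j] ∨ g sibling_j`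
  have hM : ∀ j, j < len → g (tops.getD (j + 1) []) = (g (tops.getD j []) ||
      g (R (tops.getD (j + 1) []) (s.2.getD j ([], 0, false, false)).2.1 (!(s.2.getD j ([], 0, false, false)).2.2.1))) := by
    intro j hj
    have hr : s.2.getD j ([], 0, false, false) ∈ s.2 := by rw [List.getD_eq_getElem _ _ hj]; exact List.getElem_mem hj
    have h := hnov _ hr
    rw [← forcedSplits_tops_getD_succ s hj] at h
    rw [ha1 j hj, h]
    cases (s.2.getD j ([], 0, false, false)).2.2.1
    · rfl
    · exact Bool.or_comm _ _
  -- the least newest-first index with label `1`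
  have hex : ∃ j, g (tops.getD j []) = true := ⟨len, by rw [ha2, hroot]⟩
  set jm := Nat.find hex with hjm
  have hjm_spec : g (tops.getD jm []) = true := Nat.find_spec hex
  have hjm_le : jm ≤ len := Nat.find_min' hex (by rw [ha2, hroot])
  have hjm_pos : 0 < jm := by
    rw [Nat.pos_iff_ne_zero]
    intro h
    have h0 : g (tops.getD 0 []) = false := by rw [List.getD_cons_zero]; exact hg0 _ hnil
    rw [← h, hjm_spec] at h0
    exact Bool.noConfusion h0
  have hbelow : ∀ j, j < jm → g (tops.getD j []) = false := fun j hj => by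
    simpa using Nat.find_min hex hj
  have habove : ∀ j, jm ≤ j → j ≤ len → g (tops.getD j []) = true := by
    intro j hj hjl
    induction j with
    | zero => rw [Nat.le_zero.1 hj] at hjm_spec; exact hjm_spec
    | succ j ih =>
      rcases Nat.eq_or_lt_of_le hj with h | h
      · rw [← h]; exact hjm_spec
      · rw [hM j (by omega), ih (by omega) (by omega), Bool.true_or]
  -- the drop, at the record of newest-first index `jm - 1`, chronological index `len - jm`
  refine ⟨len - jm, by omega, fun t ht => ?_, ?_, ?_⟩
  · -- the label sequence
    have hlab : (((s.2.reverse.map fun r => g r.1) ++ [g s.1]).getD t false) = g (tops.getD (len - t) []) := by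
      rcases Nat.lt_or_ge t len with h | h
      · rw [List.getD_eq_getElem _ _ (by simp; omega), List.getElem_append_left (by simp; omega)]
        have e := forcedSplits_getD_reverse_map s.2 (fun r => g r.1) ([], 0, false, false) false h
        rw [List.getD_eq_getElem _ _ (by simp; omega)] at e
        rw [e, show len - t = (s.2.length - 1 - t) + 1 by omega, forcedSplits_tops_getD_succ s (by omega)]
      · have ht' : t = len := le_antisymm ht h
        rw [ht', List.getD_eq_getElem _ _ (by simp [hlen]), List.getElem_append_right (by simp [hlen])]
        simp [hlen, htops]
    rw [hlab]
    constructor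
    · intro h
      by_contra hta
      rw [hbelow (len - t) (by omega)] at h
      exact Bool.noConfusion h
    · intro h
      exact habove (len - t) (by omega) (by omega)
  · -- the dropping record is free: a forced sibling would contain the empty clause
    have hidx : s.2.reverse.getD (len - jm) ([], 0, false, false) = s.2.getD (jm - 1) ([], 0, false, false) := by
      rw [List.getD_eq_getElem _ _ (by simp; omega), List.getD_eq_getElem _ _ (by omega), List.getElem_reverse]
      congr 1; omega
    rw [hidx]
    by_contra hf
    rw [Bool.not_eq_false] at hf
    have hr : s.2.getD (jm - 1) ([], 0, false, false) ∈ s.2 := by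
      rw [List.getD_eq_getElem _ _ (by omega)]; exact List.getElem_mem (by omega)
    have hu := hb _ hr hf
    have hpar : (s.2.getD (jm - 1) ([], 0, false, false)).1 = tops.getD jm [] := by
      rw [← forcedSplits_tops_getD_succ s (by omega)]; congr 1; omega
    have hsib := hg0 _ (hunit _ _ _ hu)
    have h := hM (jm - 1) (by omega)
    rw [show jm - 1 + 1 = jm by omega, hjm_spec, hbelow (jm - 1) (by omega), Bool.false_or, ← hpar] at h
    rw [hsib] at h
    exact Bool.noConfusion h
  · -- its sibling is labelled `1`
    have hidx : s.2.reverse.getD (len - jm) ([], 0, false, false) = s.2.getD (jm - 1) ([], 0, false, false) := by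
      rw [List.getD_eq_getElem _ _ (by simp; omega), List.getD_eq_getElem _ _ (by omega), List.getElem_reverse]
      congr 1; omega
    rw [hidx]
    have hpar : (s.2.getD (jm - 1) ([], 0, false, false)).1 = tops.getD jm [] := by
      rw [← forcedSplits_tops_getD_succ s (by omega)]; congr 1; omega
    have h := hM (jm - 1) (by omega)
    rw [show jm - 1 + 1 = jm by omega, hjm_spec, hbelow (jm - 1) (by omega), Bool.false_or, ← hpar] at h
    exact h.symm

end Summit.PneNP.PneNP.Theorems
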